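import Summits.BirchSwinnertonDyer.BirchSwinnertonDyer.Theorems.ByReductionTypeAtTwoAdditiveKatoTransportQuadraticLayer
import Summits.BirchSwinnertonDyer.BirchSwinnertonDyer.Theorems.ByReductionTypeAtTwoAdditiveSelmerBaseChangeModelIso
import Summits.BirchSwinnertonDyer.Rank1Residual.AdditivePotMult.TwistPointsOver
import Literature.NumberTheory.EllipticCurves.ZpExtensionRestrictTwoSqrtTwo
import Literature.NumberTheory.EllipticCurves.ZpExtensionRestrictProofs
import Literature.NumberTheory.EllipticCurves.ZpExtensionRestrictCyclotomic
import Literature.NumberTheory.EllipticCurves.IwasawaSelmerModuleFiniteProofs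
import Literature.NumberTheory.EllipticCurves.HeegnerPointsImaginaryQuadraticProofs
import Literature.NumberTheory.EllipticCurves.GeomPointsGaloisModule
import Literature.NumberTheory.QuadraticFields.SquareRootGenerator
import HarnessLib

/-!
# Route ByReductionTypeAtTwo, crux `AdditivePotMultOverKAtTwo` (stmt-BirchSwinnertonDyer-22618) — T20 (a) «twist
# decomposition»: THE MODEL IDENTIFICATION `Sel_{2^∞}((E′)_{ℚ(i)}/ℚ(i)_∞) ≃ Sel_{2^∞}(E′/ℚ_∞(i))` CONSTRUCTED, and
# the (−1)-split-twist-block doors of `…AdditiveKatoTransportQuadraticLayer` with `ΘS`/`hΘS` DISCHARGED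

Cell `bsd-2adic`, seat `bsd-2adic-t42` GEN 24 (Stage B of memo `t42/DESIGN-T42-ADDENDUM-27.md` §A27.3 = GEN 23's named
successor key). HONEST FRAMING (D-0036 / D-0054): theorems only; types-the-object-of (the ONE displayed model identification
of `Theorems/ByReductionTypeAtTwoAdditiveKatoTransportQuadraticLayer` ↦ KERNEL); closes none; nothing booked; BSD is not proved
by any of this. PARTITION: X5@2 additive, C4″ 22618 (−1)-split-twist block (and, through k4-w3's R15 kernel, the (−2)-block)
× `p = 2`.

What was displayed (A3 = `…AdditiveKatoTransportQuadraticLayer`, GEN 23): an additive isomorphism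
`ΘS : (W′.baseChange F).selmerInfty κ_F ≃+ W′.selmerGroupOver 2 (kerStab κ θ)` commuting with `conj_{γ_F}` / `conj_γ`, for a
number field `F`, a `ℤ₂`-extension `κ_F` of `F` and `γ_F ∈ Γ_F` — Selmer base change along `F = ℚ(i)` at the infinite level.
This file CONSTRUCTS it for every quadratic field `F ∋ θ_F`, `θ_F² = −1` (all are `ℚ`-isomorphic to `ℚ(i)`):

* §1 `exists_selmerGroupOver_addEquiv_of_eq` — Selmer groups over EQUAL normal subgroups `H₁ = H₂ ≤ Γ_K` are identified by
  restriction (both ways; `resOfLe_mem_selmerGroupOver`, `resOfLe_comp`, `resOfLe_refl`).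
* §2 the quadratic field `F ∋ θ_F`, `θ_F² = −1`: `θ_F ∉ ℚ`; `F` imaginary quadratic, `√2 ∉ F`; `Gal(ℚ̄/F) = galRange F` is
  the stabiliser of ANY `θ ∈ ℚ̄` with `θ² = −1` (`θ = ±t_F`, additive-p1's `rootInClosure` sign rules); the cyclotomic
  `ℤ₂`-extension restricts SURJECTIVELY to `Γ_F` (`F ∩ ℚ_∞ = ℚ`: tree `surjective_comp_absGaloisRestrict_of_forall_sq_ne_two`),
  and `galImage F (ker κ_F) = ker κ ⊓ Stab θ = kerStab κ θ` for `κ_F = κ ∘ res`.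
* §3 **`exists_selmerInfty_model`**: for `κ` the cyclotomic `ℤ₂`-extension of `ℚ`, `γ` a topological generator fixing `θ`
  (`θ² = −1`), and such an `F`: THERE ARE `κ_F` (cyclotomic, `= κ ∘ res`), `γ_F` (a topological generator, `res γ_F = γ`) and
  `ΘS : Sel_{2^∞}((W′)_F/F_∞) ≃+ W′.selmerGroupOver 2 (kerStab κ θ)` with `ΘS ∘ conj_{γ_F} = conj_γ ∘ ΘS` — the composite of
  GEN 24's `SelmerBaseChange.selmerModelIso` (p701196 + b2b-bsdres place bookkeeping, EXACT identification: no corestriction,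
  no factor `2`) with §1 along `galImage F (ker κ_F) = kerStab κ θ`.
* §4 the statements of A3 with the model DISCHARGED: **`lengthAt_selmerDual_symm_of_quadraticField`** (T20 (a) BY NAME:
  `ℓ_𝔮(X(W/ℚ_∞)) = ℓ_{ι𝔮}(X(W/ℚ_∞))` at height-one `𝔮 ∌ 2` for the ADDITIVE `W` from Greenberg 1.14 ×2 (PRINT) + torsion of
  `X(W′/ℚ_∞)`, `X(W/ℚ_∞)`), and the two PRINT-EXACT FE doors
  **`lengthAt_selmerDualContra_le_of_oddBranchInputsPrintExact_fe_of_quadraticField`** (key `γ⁻¹`) /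
  **`lengthAt_selmerDual_le_of_oddBranchInputsPrintExact_fe_of_quadraticField`** (key `γ`). Compared with A3: the binders
  `κF, γF, hκF, hγF, DF, [Module.Finite DF.X], [(kerStab κ θ).Normal], ΘS, hΘS` are GONE (constructed: `κ.restrict`,
  a lift of `γ`, the canonical dual `selmerDualData` with `module_finite_holds`, `normal_kerStab`, §3); added: the field data
  `(F, θ_F, θ_F² = −1, [F : ℚ] = 2)` (any model of `ℚ(i)`; `hF` = `W′` split multiplicative above `2` over `F` stays displayed,
  as in A3).

References: [GreenbergLNM1716] §1 p. 60, Thm. 1.14 p. 68, §2, §4 p. 107; [DokchitserDokchitserAnnals2010] Lemma 4.14;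
[SerreGaloisCohomology1997] I.§2.4–2.5, II.§1.1; [Washington1997] §13.1; [Marcus1977] Ch. 2 Thm. 1; [Kato2004Asterisque]
Thm. 12.4, 12.5 (3), §17.13; [MazurTateTeitelbaum1986Invent] §I.17; memo `run/shared/lean/pub/bsd-2adic/t42/DESIGN-T42-ADDENDUM-28.md`.
-/

set_option autoImplicit false
-- the summit's namespace `Summit.BirchSwinnertonDyer.BirchSwinnertonDyer` (Sub = Summit) trips `dupNamespace`
set_option linter.dupNamespace false

noncomputable section

open scoped Classical MatrixGroups ModularForm NumberField

open Field CongruenceSubgroup WeierstrassCurve IsDedekindDomain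
  Literature.NumberTheory.EllipticCurves Literature.NumberTheory.EllipticCurves.ModularForms
  Literature.NumberTheory.EllipticCurves.Module Literature.NumberTheory.EllipticCurves.QuadraticLayer
  Literature.NumberTheory.EllipticCurves.BaseChangeModel Literature.NumberTheory.GaloisRepresentations
  Summit.BirchSwinnertonDyer.Rank1Residual.AdditivePotMult

namespace Summit.BirchSwinnertonDyer.BirchSwinnertonDyer.Theorems.AddKatoTwoQuadLayerModel

universe u

/-! ## §1 Selmer groups over equal normal subgroups -/

section Congr

variable {K : Type u} [Field K] [NumberField K] (V : WeierstrassCurve K) (p : ℕ)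

/-- **`Sel_{p^∞}(E/K̄^{H₁}) ≃+ Sel_{p^∞}(E/K̄^{H₂})` for EQUAL normal subgroups `H₁ = H₂`**, by restriction along the two
inclusions (mutually inverse: `resOfLe_comp`, `resOfLe_refl`; Selmer groups are respected: `resOfLe_mem_selmerGroupOver`),
with its values in `H¹(H₂, E[p^∞])`. An existence statement (no definition). [cite: GreenbergLNM1716, §1 p. 60]
[cite: SerreGaloisCohomology1997, I.§2.5] -/
theorem exists_selmerGroupOver_addEquiv_of_eq {H₁ H₂ : Subgroup (absoluteGaloisGroup K)} [H₁.Normal] [H₂.Normal]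
    (h : H₁ = H₂) :
    ∃ Ψ : V.selmerGroupOver p H₁ ≃+ V.selmerGroupOver p H₂,
      ∀ s, ((Ψ s : V.selmerGroupOver p H₂) : V.subgroupH1 p H₂) = V.resOfLe p h.ge s := by
  let f : V.selmerGroupOver p H₁ →+ V.selmerGroupOver p H₂ :=
    ((V.resOfLe p h.ge).comp (V.selmerGroupOver p H₁).subtype).codRestrict _
      fun s ↦ V.resOfLe_mem_selmerGroupOver p h.ge s.2
  let g : V.selmerGroupOver p H₂ →+ V.selmerGroupOver p H₁ :=
    ((V.resOfLe p h.le).comp (V.selmerGroupOver p H₂).subtype).codRestrict _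
      fun s ↦ V.resOfLe_mem_selmerGroupOver p h.le s.2
  have hgf : ∀ s, g (f s) = s := fun s ↦ by
    apply Subtype.ext
    change ((V.resOfLe p h.le).comp (V.resOfLe p h.ge)) (s : V.subgroupH1 p H₁) = s
    rw [V.resOfLe_comp_holds p]
    exact congrArg (fun φ ↦ φ (s : V.subgroupH1 p H₁)) (resOfLe_refl_holds (M := V.geomPrimaryTorsion p) H₁)
  have hfg : ∀ s, f (g s) = s := fun s ↦ by
    apply Subtype.ext
    change ((V.resOfLe p h.ge).comp (V.resOfLe p h.le)) (s : V.subgroupH1 p H₂) = s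
    rw [V.resOfLe_comp_holds p]
    exact congrArg (fun φ ↦ φ (s : V.subgroupH1 p H₂)) (resOfLe_refl_holds (M := V.geomPrimaryTorsion p) H₂)
  exact ⟨AddMonoidHom.toAddEquiv f g (AddMonoidHom.ext hgf) (AddMonoidHom.ext hfg), fun s ↦ rfl⟩

end Congr

/-! ## §2 The quadratic field `F ∋ θ_F`, `θ_F² = −1` -/

section Field

variable (F : Type) [Field F] [NumberField F] {θF : F} (hθF : θF ^ 2 = -1) (hF2 : Module.finrank ℚ F = 2)

include hθF in
/-- `θ_F² = −1` in the `algebraMap` form of the tree's quadratic-field lemmas. [folklore] -/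
theorem sq_eq_algebraMap_neg_one : θF ^ 2 = algebraMap ℚ F (-1) := by
  rw [hθF, map_neg, map_one]

include hθF in
/-- `θ_F ∉ ℚ` (`−1` is not a rational square). [folklore] -/
theorem not_mem_range_algebraMap : θF ∉ Set.range (algebraMap ℚ F) := by
  rintro ⟨q, hq⟩
  have h : algebraMap ℚ F (q ^ 2) = algebraMap ℚ F (-1) := by rw [map_pow, hq, hθF, map_neg, map_one]
  have hq2 : q ^ 2 = -1 := (algebraMap ℚ F).injective h
  nlinarith [sq_nonneg q]

include hθF hF2 in
/-- `F` is imaginary quadratic (`F = ℚ(√−1)`). [cite: Marcus1977, Ch. 2 Thm. 1] -/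
theorem isImaginaryQuadratic : IsImaginaryQuadratic F :=
  IsImaginaryQuadratic.of_sq_eq hF2 (sq_eq_algebraMap_neg_one F hθF) (by norm_num)

include hθF hF2 in
-- adapted from `Theorems/TwoAdicConverseOrdLambdaHalfAtTwoShapiroLatticeSupply.lean` (`sq_ne_two`, conv-1 GEN 30)
/-- **`√2 ∉ F`**: a solution of `x² = 2` in `F` is irrational, so `F = ℚ(x)` and `d_F = 2·q²` would be positive
(`NumberField.exists_discr_eq_mul_sq`), against `d_F < 0`. [cite: Marcus1977, Ch. 2 Thm. 1] -/
theorem sq_ne_two (x : F) : x ^ 2 ≠ 2 := by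
  have hK := isImaginaryQuadratic F hθF hF2
  intro hx
  have hx' : x ^ 2 = algebraMap ℚ F 2 := by rw [hx, map_ofNat]
  have hxK : x ∉ Set.range (algebraMap ℚ F) := by
    rintro ⟨q, rfl⟩
    have hq : (q : ℝ) ^ 2 = 2 := by
      rw [← map_pow] at hx'
      have := (algebraMap ℚ F).injective hx'
      exact_mod_cast congrArg (fun r : ℚ ↦ (r : ℝ)) this
    refine irrational_sqrt_two ⟨|q|, ?_⟩
    rw [Rat.cast_abs, ← Real.sqrt_sq_eq_abs, hq]
  obtain ⟨q, hq0, hq⟩ := NumberField.exists_discr_eq_mul_sq hK.1 hxK hx'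
  have hneg : (NumberField.discr F : ℚ) < 0 := by exact_mod_cast hK.discr_neg
  have hpos : (0 : ℚ) < 2 * q ^ 2 := by positivity
  linarith

include hθF hF2 in
/-- **`Gal(ℚ̄/F) = Stab(θ)` for every `θ ∈ ℚ̄` with `θ² = −1`**: `θ = ±t_F` for the image `t_F = rootInClosure F θ_F` of
`θ_F` in `ℚ̄`, and `σ ∈ galRange F` iff `σ` fixes `t_F` (sign rules `apply_rootInClosure_of_(not_)mem`).
[cite: Marcus1977, Ch. 2 Thm. 1] [cite: SerreGaloisCohomology1997, II.§1.1] -/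
theorem mem_galRange_iff_smul_eq {θ : AlgebraicClosure ℚ} (hθ : θ ^ 2 = algebraMap ℚ (AlgebraicClosure ℚ) (-1))
    (σ : absoluteGaloisGroup ℚ) : σ ∈ galRange (K := ℚ) F ↔ σ • θ = θ := by
  have hθF' := sq_eq_algebraMap_neg_one F hθF
  have hnot := not_mem_range_algebraMap F hθF
  -- `σ ∈ galRange F ↔ σ t_F = t_F`
  have key : σ ∈ galRange (K := ℚ) F ↔ σ • rootInClosure F θF = rootInClosure F θF := by
    constructor
    · exact fun h ↦ apply_rootInClosure_of_mem F h
    · intro h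
      by_contra hσ
      have hneg : σ • rootInClosure F θF = -rootInClosure F θF := apply_rootInClosure_of_not_mem F hF2 hnot hθF' hσ
      rw [h] at hneg
      have h2 : (2 : AlgebraicClosure ℚ) * rootInClosure F θF = 0 := by rw [two_mul]; nth_rw 2 [hneg]; rw [add_neg_cancel]
      rcases mul_eq_zero.mp h2 with h0 | h0
      · exact two_ne_zero h0
      · have hsq := rootInClosure_sq F hθF'
        rw [h0, zero_pow two_ne_zero, map_neg, map_one] at hsq
        exact one_ne_zero (neg_eq_zero.mp hsq.symm)
  -- `θ = ±t_F`
  have hsq : θ ^ 2 = rootInClosure F θF ^ 2 := by rw [hθ, rootInClosure_sq F hθF']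
  rw [key]
  rcases sq_eq_sq_iff_eq_or_eq_neg.mp hsq with h | h
  · rw [h]
  · rw [h, smul_neg, neg_inj]

variable (κ : ZpExtension ℚ 2) (hκ : κ.IsCyclotomic)

include hθF hF2 hκ in
/-- **`κ ∘ res : Γ_F → ℤ₂` is onto** for the cyclotomic `ℤ₂`-extension `κ` of `ℚ` (`F ∩ ℚ_∞ = ℚ`: `[F : ℚ] = 2` and
`√2 ∉ F`; tree `surjective_comp_absGaloisRestrict_of_forall_sq_ne_two`). [cite: Washington1997, §13.1] -/
theorem surjective_comp_absGaloisRestrict :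
    Function.Surjective (κ.toContinuousMonoidHom.comp (absGaloisRestrict ℚ F)) :=
  ZpExtension.surjective_comp_absGaloisRestrict_of_forall_sq_ne_two κ F hκ (by rw [hF2]; decide) (sq_ne_two F hθF hF2)

include hθF hF2 in
/-- **`galImage F (ker κ_F) = kerStab κ θ`** for `κ_F = κ ∘ res` (`ker κ_F = res⁻¹(ker κ)`, `kerSubgroup_restrict`) and
`θ² = −1`: `res(ker κ_F) = ker κ ⊓ galRange F = ker κ ⊓ Stab(θ) = Gal(ℚ̄/ℚ_∞(θ))`. [cite: Washington1997, §13.1]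
[cite: GreenbergLNM1716, §4 p. 107] -/
theorem galImage_kerSubgroup_restrict_eq_kerStab (h : Function.Surjective (κ.toContinuousMonoidHom.comp (absGaloisRestrict ℚ F)))
    {θ : AlgebraicClosure ℚ} (hθ : θ ^ 2 = algebraMap ℚ (AlgebraicClosure ℚ) (-1)) :
    galImage ℚ F (κ.restrict F h).kerSubgroup = kerStab κ θ := by
  ext g
  rw [mem_galImage_iff, mem_kerStab_iff]
  constructor
  · rintro ⟨σ, hσ, rfl⟩
    rw [ZpExtension.kerSubgroup_restrict, Subgroup.mem_comap] at hσ
    refine ⟨?_, (mem_galRange_iff_smul_eq F hθF hF2 hθ _).mp ⟨σ, rfl⟩⟩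
    rw [resGal_eq_absGaloisRestrict]
    exact hσ
  · rintro ⟨hker, hfix⟩
    obtain ⟨σ, rfl⟩ := (mem_galRange_iff_smul_eq F hθF hF2 hθ g).mpr hfix
    refine ⟨σ, ?_, rfl⟩
    rw [ZpExtension.kerSubgroup_restrict, Subgroup.mem_comap]
    rw [resGal_eq_absGaloisRestrict] at hker
    exact hker

end Field

/-! ## §3 The model identification -/

section Model

variable (κ : ZpExtension ℚ 2) (hκ : κ.IsCyclotomic) (W' : WeierstrassCurve ℚ)
  {θ : AlgebraicClosure ℚ} (hθ : θ ^ 2 = algebraMap ℚ (AlgebraicClosure ℚ) (-1))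
  {γ : absoluteGaloisGroup ℚ} (hγ : κ.IsTopGenerator γ) (hγθ : γ • θ = θ)
  (F : Type) [Field F] [NumberField F] {θF : F} (hθF : θF ^ 2 = -1) (hF2 : Module.finrank ℚ F = 2)

include hκ hθ hγ hγθ hθF hF2 in
/-- **THE MODEL IDENTIFICATION (Stage B of t42 GEN 23's memo, §A27.3)**: for the cyclotomic `ℤ₂`-extension `κ` of `ℚ`, a
topological generator `γ` fixing `θ` (`θ² = −1`) and a quadratic field `F ∋ θ_F` (`θ_F² = −1`), there are a CYCLOTOMIC
`ℤ₂`-extension `κ_F` of `F` with `κ_F = κ ∘ res`, a topological generator `γ_F` with `res γ_F = γ`, and an additive isomorphism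
`ΘS : Sel_{2^∞}((W′)_F/F_∞) ≃+ W′.selmerGroupOver 2 (kerStab κ θ)` (the tree's subgroup model of `Sel_{2^∞}(W′/ℚ_∞(θ))`)
with `ΘS ∘ conj_{γ_F} = conj_γ ∘ ΘS` — EXACTLY the hypotheses `(κF, γF, hκF, hγF, ΘS, hΘS)` of
`AddKatoTwoQuadLayer.lengthAt_selmerDual_symm_of_model`. Composite of `SelmerBaseChange.selmerModelIso` (Selmer base change
along `F/ℚ` at the level `F̄^{ker κ_F} = ℚ̄^{ker κ ⊓ Stab θ}`) with §1 along `galImage F (ker κ_F) = kerStab κ θ`.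
[cite: GreenbergLNM1716, §2 and §4 p. 107] [cite: SerreGaloisCohomology1997, I.§2.5, II.§1.1] [cite: Washington1997, §13.1] -/
theorem exists_selmerInfty_model [(kerStab κ θ).Normal] :
    ∃ (κF : ZpExtension F 2) (γF : absoluteGaloisGroup F), κF.IsCyclotomic ∧ κF.IsTopGenerator γF ∧
      (∀ σ, κF σ = κ (absGaloisRestrict ℚ F σ)) ∧ resGal (K := ℚ) F γF = γ ∧
      ∃ ΘS : (W'.baseChange F).selmerInfty κF ≃+ W'.selmerGroupOver 2 (kerStab κ θ),
        ∀ s, ((ΘS ((W'.baseChange F).conjSelmerInfty κF γF s) : W'.selmerGroupOver 2 (kerStab κ θ)) :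
            W'.subgroupH1 2 (kerStab κ θ)) = W'.conjH1 2 (kerStab κ θ) γ (ΘS s : W'.selmerGroupOver 2 (kerStab κ θ)) := by
  have hsurj := surjective_comp_absGaloisRestrict F hθF hF2 κ hκ
  set κF := κ.restrict F hsurj with hκFdef
  -- the lift `γF` of `γ ∈ Stab θ = galRange F`
  obtain ⟨γF, hγF⟩ := (mem_galRange_iff_smul_eq F hθF hF2 hθ γ).mpr hγθ
  have hgal : galImage ℚ F κF.kerSubgroup = kerStab κ θ := galImage_kerSubgroup_restrict_eq_kerStab F hθF hF2 κ hsurj hθ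
  haveI : (galImage ℚ F κF.kerSubgroup).Normal := by rw [hgal]; infer_instance
  haveI : IsGalois ℚ F := by
    haveI : Algebra.IsQuadraticExtension ℚ F := ⟨hF2⟩
    infer_instance
  have hγres : absGaloisRestrict ℚ F γF = γ := by rw [← resGal_eq_absGaloisRestrict]; exact hγF
  refine ⟨κF, γF, ZpExtension.isCyclotomic_restrict κ hκ F hsurj, ?_, fun σ ↦ rfl, hγF, ?_⟩
  · rw [ZpExtension.isTopGenerator_restrict_iff, hγres]
    exact hγ
  obtain ⟨Ψ, hΨ⟩ := exists_selmerGroupOver_addEquiv_of_eq W' 2 hgal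
  refine ⟨(SelmerBaseChange.selmerModelIso F κF.kerSubgroup W' 2).trans Ψ, fun s ↦ ?_⟩
  show ((Ψ (SelmerBaseChange.selmerModelIso F κF.kerSubgroup W' 2 ((W'.baseChange F).conjSelmerInfty κF γF s)) :
      W'.selmerGroupOver 2 (kerStab κ θ)) : W'.subgroupH1 2 (kerStab κ θ)) =
    W'.conjH1 2 (kerStab κ θ) γ (Ψ (SelmerBaseChange.selmerModelIso F κF.kerSubgroup W' 2 s))
  rw [hΨ, hΨ]
  have h1 : ((SelmerBaseChange.selmerModelIso F κF.kerSubgroup W' 2 ((W'.baseChange F).conjSelmerInfty κF γF s) :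
      W'.selmerGroupOver 2 (galImage ℚ F κF.kerSubgroup)) : W'.subgroupH1 2 (galImage ℚ F κF.kerSubgroup)) =
      W'.conjH1 2 (galImage ℚ F κF.kerSubgroup) γ
        (SelmerBaseChange.selmerModelIso F κF.kerSubgroup W' 2 s : W'.selmerGroupOver 2 (galImage ℚ F κF.kerSubgroup)) := by
    rw [← hγF]
    exact SelmerBaseChange.coe_selmerModelIso_conjH1 F κF.kerSubgroup W' 2 γF s
  rw [h1]
  exact DFunLike.congr_fun (resOfLe_comp_conjH1_holds (M := W'.geomPrimaryTorsion 2) hgal.ge γ) _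

end Model

/-! ## §4 T20 (a) and the (−1)-block doors with the model identification DISCHARGED -/

section Doors

variable (h114 : Greenberg1999_thm114_charIdeal_iota_invariant)
  (h114F : Greenberg1999.thm114_charIdeal_iota_invariant_splitMult_baseChange)
  (W' : WeierstrassCurve ℚ) [W'.IsElliptic] [W'.IsGloballyMinimal] (hmult' : W'.HasMultiplicativeReductionAtPrime 2)
  (W : WeierstrassCurve ℚ) {V : VariableChange ℚ} (hV : V • W = W'.quadraticTwist (-1))
  {θ : AlgebraicClosure ℚ} (hθ : θ ^ 2 = algebraMap ℚ (AlgebraicClosure ℚ) (-1))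
  (κ : ZpExtension ℚ 2) (γ : absoluteGaloisGroup ℚ) (hκ : κ.IsCyclotomic) (hγ : κ.IsTopGenerator γ) (hγθ : γ • θ = θ)
  (D' : W'.SelmerDualData κ γ) [Module.Finite (IwasawaAlgebra 2) D'.X] (hD' : D'.IsTorsion)
  (D : W.SelmerDualData κ γ) (hD : D.IsTorsion)

include h114 h114F hmult' hV hθ hκ hγ hγθ hD' hD in
/-- **T20 (a) BY NAME, model identification DISCHARGED: `ℓ_𝔮(X(E/ℚ_∞)) = ℓ_{ι𝔮}(X(E/ℚ_∞))` at every height-one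
`𝔮 ∌ 2`** for the ADDITIVE curve `E = W` (`W` a `ℚ`-model of `E′^{(−1)}`, `E′ = W′` multiplicative at `2`, split
multiplicative above `2` over the quadratic field `F ∋ √−1`), from Greenberg's Thm 1.14 over `ℚ` and over `F` (PRINT ×2), the
torsion of `X(E′/ℚ_∞)` and `X(E/ℚ_∞)` — and NOTHING ELSE: the `F`-side tower `κ_F = κ ∘ res`, generator `γ_F`, the canonical
dual `X((E′)_F/F_∞)` (`selmerDualData`, finitely generated by `module_finite_holds`) and the identification `ΘS` of
`AddKatoTwoQuadLayer.lengthAt_selmerDual_symm_of_model` are all constructed (`exists_selmerInfty_model`).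
[cite: GreenbergLNM1716, Thm. 1.14 (p. 68) and §1 (p. 60)] [cite: DokchitserDokchitserAnnals2010, Lemma 4.14] -/
theorem lengthAt_selmerDual_symm_of_quadraticField
    -- the quadratic field `F = ℚ(√−1)` (any model) over which `W′` is split multiplicative above `2`
    (F : Type) [Field F] [NumberField F] {θF : F} (hθF : θF ^ 2 = -1) (hF2 : Module.finrank ℚ F = 2)
    (hF : ∀ v : HeightOneSpectrum (𝓞 F), (2 : 𝓞 F) ∈ v.asIdeal → (W'.baseChange F).HasSplitMultiplicativeReductionAt v)
    (𝔮 : PrimeSpectrum (IwasawaAlgebra 2)) (h𝔮 : 𝔮.asIdeal.height = 1) (hp𝔮 : PowerSeries.C (2 : ℤ_[2]) ∉ 𝔮.asIdeal) :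
    lengthAt (IwasawaAlgebra 2) D.X 𝔮 =
      lengthAt (IwasawaAlgebra 2) D.X (PrimeSpectrum.comap (IwasawaAlgebra.invol 2).toRingHom 𝔮) := by
  haveI : Fact (Nat.Prime 2) := ⟨Nat.prime_two⟩
  haveI : (kerStab κ θ).Normal := normal_kerStab κ hθ
  obtain ⟨κF, γF, hκF, hγF, -, -, ΘS, hΘS⟩ := exists_selmerInfty_model κ hκ W' hθ hγ hγθ F hθF hF2
  let DF : (W'.baseChange F).SelmerDualData κF γF := (W'.baseChange F).selmerDualData κF hγF
  haveI : Module.Finite (IwasawaAlgebra 2) DF.X := DF.module_finite_holds hγF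
  exact AddKatoTwoQuadLayer.lengthAt_selmerDual_symm_of_model h114 h114F W' hmult' W hV hθ κ γ hκ hγ hγθ D' hD' D hD F hF κF γF
    hκF hγF DF ΘS hΘS 𝔮 h𝔮 hp𝔮

end Doors

section PrintExactDoors

variable (h12 : Kato2004.thm12_4) (hPE : AddKatoTwo.KatoOddBranchInputsAtTwoNegOneSplitTwistPrintExact)
  (h114 : Greenberg1999_thm114_charIdeal_iota_invariant)
  (h114F : Greenberg1999.thm114_charIdeal_iota_invariant_splitMult_baseChange)
  -- the additive curve `W` on the (−1)-block and a globally minimal model `W′` of its twist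
  (W : WeierstrassCurve ℚ) [W.IsElliptic] [W.IsGloballyMinimal] [ContinuousSMul ℤ_[2] (W.tateModule 2)]
  (W' : WeierstrassCurve ℚ) [W'.IsElliptic] [W'.IsGloballyMinimal] (hmult' : W'.HasMultiplicativeReductionAtPrime 2)
  {V : VariableChange ℚ} (hV : V • W = W'.quadraticTwist (-1))
  {θ : AlgebraicClosure ℚ} (hθ : θ ^ 2 = algebraMap ℚ (AlgebraicClosure ℚ) (-1))
  {N : ℕ} [NeZero N] (f : CuspForm (Gamma0 N) 2) (κ : ZpExtension ℚ 2) (γ : absoluteGaloisGroup ℚ)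
  (hsp : (W.quadraticTwist (-1)).HasSplitMultiplicativeReductionAtPrime 2)
  (hirr : W.HasIrreducibleModPGaloisRep 2) (hκ : κ.IsCyclotomic) (hγ : κ.IsTopGenerator γ)
  (hγ' : IsCyclotomicVariable 2 γ) (hγθ : γ • θ = θ) (hf : IsNewformOf (W.quadraticTwist (-1)) f)
  (I : Kato2004.IwasawaH1Data W 2 κ γ)
  -- torsion of the two `ℚ`-side Iwasawa modules (key `γ`)
  (D₀' : W'.SelmerDualData κ γ) [Module.Finite (IwasawaAlgebra 2) D₀'.X] (hD₀' : D₀'.IsTorsion)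
  (D₀ : W.SelmerDualData κ γ) (hD₀ : D₀.IsTorsion)
  -- the `2`-adic `L`-function side
  (Lt : IwasawaAlgebra 2) (m : ℕ)
  (hLt : iwasawaToPowerSeries 2 Lt = PowerSeries.C ((2 : ℚ_[2]) ^ m) * padicLFunctionMinusBranchMult f (1 : ℚ_[2]) 1)
  (hLt0 : Lt ≠ 0)

include h12 hPE h114 h114F hmult' hV hθ hsp hirr hκ hγ hγ' hγθ hf I hD₀' hD₀ hLt hLt0 in
/-- **KEY-`γ⁻¹` PRINT-EXACT DOOR with T20 (a), T20 (d) AND the model identification in the kernel**: `ℓ_𝔮(X′) ≤ ℓ_𝔮(Λ/(L̃))`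
at every height-one `𝔮 ∌ 2` for every key-`γ⁻¹` dual Selmer datum `D′` of the ADDITIVE `W` (`W^{(−1)}` split multiplicative
at `2`, `W[2]` irreducible) — `AddKatoTwoQuadLayer.lengthAt_selmerDualContra_le_of_oddBranchInputsPrintExact_fe_of_model` with
`(κF, γF, DF, ΘS, hΘS)` SUPPLIED by `exists_selmerInfty_model` / `selmerDualData`. Displayed: `Kato2004.thm12_4` (PRINT), the
PRINT-EXACT typed input, Greenberg 1.14 ×2 (PRINT), torsion of `X(W′/ℚ_∞)`, `X(W/ℚ_∞)`, `W′` split multiplicative above `2`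
over `F ∋ √−1`, `L̃ = 2^m L⁻ ≠ 0`. [cite: Kato2004Asterisque, Thm. 12.4 (2) (p. 221), Thm. 12.5 (3) and (12.5.1) (p. 222), §17.13 (pp. 279–280)]
[cite: GreenbergLNM1716, Thm. 1.14 (p. 68)] [cite: MazurTateTeitelbaum1986Invent, §I.17] -/
theorem lengthAt_selmerDualContra_le_of_oddBranchInputsPrintExact_fe_of_quadraticField
    -- the quadratic field `F = ℚ(√−1)` (any model) over which `W′` is split multiplicative above `2`
    (F : Type) [Field F] [NumberField F] {θF : F} (hθF : θF ^ 2 = -1) (hF2 : Module.finrank ℚ F = 2)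
    (hF : ∀ v : HeightOneSpectrum (𝓞 F), (2 : 𝓞 F) ∈ v.asIdeal → (W'.baseChange F).HasSplitMultiplicativeReductionAt v)
    (D' : W.SelmerDualData κ γ⁻¹)
    (𝔮 : PrimeSpectrum (IwasawaAlgebra 2)) (h𝔮 : 𝔮.asIdeal.height = 1) (hp𝔮 : PowerSeries.C (2 : ℤ_[2]) ∉ 𝔮.asIdeal) :
    lengthAt (IwasawaAlgebra 2) D'.X 𝔮 ≤ lengthAt (IwasawaAlgebra 2) (IwasawaAlgebra 2 ⧸ Ideal.span {Lt}) 𝔮 := by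
  haveI : Fact (Nat.Prime 2) := ⟨Nat.prime_two⟩
  haveI : (kerStab κ θ).Normal := normal_kerStab κ hθ
  obtain ⟨κF, γF, hκF, hγF, -, -, ΘS, hΘS⟩ := exists_selmerInfty_model κ hκ W' hθ hγ hγθ F hθF hF2
  let DF : (W'.baseChange F).SelmerDualData κF γF := (W'.baseChange F).selmerDualData κF hγF
  haveI : Module.Finite (IwasawaAlgebra 2) DF.X := DF.module_finite_holds hγF
  exact AddKatoTwoQuadLayer.lengthAt_selmerDualContra_le_of_oddBranchInputsPrintExact_fe_of_model h12 hPE h114 h114F W W'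
    hmult' hV hθ f κ γ hsp hirr hκ hγ hγ' hγθ hf I D₀' hD₀' D₀ hD₀ F hF κF γF hκF hγF DF ΘS hΘS Lt m hLt hLt0 D' 𝔮 h𝔮 hp𝔮

include h12 hPE h114 h114F hmult' hV hθ hsp hirr hκ hγ hγ' hγθ hf I hD₀' hD₀ hLt hLt0 in
/-- **KEY-`γ` DOOR with T20 (a), T20 (d) AND the model identification in the kernel**: `ℓ_𝔮(X(W/ℚ_∞)) ≤ ℓ_𝔮(Λ/(L̃))` at
every height-one `𝔮 ∌ 2` for every key-`γ` dual Selmer datum `D` of the additive `W` —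
`AddKatoTwoQuadLayer.lengthAt_selmerDual_le_of_oddBranchInputsPrintExact_fe_of_model` with the model supplied. Compared with
addL2x's `AddKatoTwo.lengthAt_selmerDual_le_of_oddBranchInputsPrintExact` (p683821) the binder `hXι` is now
{Greenberg 1.14 ×2 (PRINT), torsion of `X(W′/ℚ_∞)`, `X(W/ℚ_∞)`, `W′` split multiplicative above `2` over `F ∋ √−1`} — no
model identification, no `F`-side tower/generator/dual.
[cite: Kato2004Asterisque, Thm. 12.4 (2) (p. 221), Thm. 12.5 (3) and (12.5.1) (p. 222), §17.13 (pp. 279–280)]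
[cite: GreenbergLNM1716, Thm. 1.14 (p. 68)] [cite: MazurTateTeitelbaum1986Invent, §I.17] -/
theorem lengthAt_selmerDual_le_of_oddBranchInputsPrintExact_fe_of_quadraticField
    -- the quadratic field `F = ℚ(√−1)` (any model) over which `W′` is split multiplicative above `2`
    (F : Type) [Field F] [NumberField F] {θF : F} (hθF : θF ^ 2 = -1) (hF2 : Module.finrank ℚ F = 2)
    (hF : ∀ v : HeightOneSpectrum (𝓞 F), (2 : 𝓞 F) ∈ v.asIdeal → (W'.baseChange F).HasSplitMultiplicativeReductionAt v)
    (D : W.SelmerDualData κ γ)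
    (𝔮 : PrimeSpectrum (IwasawaAlgebra 2)) (h𝔮 : 𝔮.asIdeal.height = 1) (hp𝔮 : PowerSeries.C (2 : ℤ_[2]) ∉ 𝔮.asIdeal) :
    lengthAt (IwasawaAlgebra 2) D.X 𝔮 ≤ lengthAt (IwasawaAlgebra 2) (IwasawaAlgebra 2 ⧸ Ideal.span {Lt}) 𝔮 := by
  haveI : Fact (Nat.Prime 2) := ⟨Nat.prime_two⟩
  haveI : (kerStab κ θ).Normal := normal_kerStab κ hθ
  obtain ⟨κF, γF, hκF, hγF, -, -, ΘS, hΘS⟩ := exists_selmerInfty_model κ hκ W' hθ hγ hγθ F hθF hF2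
  let DF : (W'.baseChange F).SelmerDualData κF γF := (W'.baseChange F).selmerDualData κF hγF
  haveI : Module.Finite (IwasawaAlgebra 2) DF.X := DF.module_finite_holds hγF
  exact AddKatoTwoQuadLayer.lengthAt_selmerDual_le_of_oddBranchInputsPrintExact_fe_of_model h12 hPE h114 h114F W W' hmult' hV
    hθ f κ γ hsp hirr hκ hγ hγ' hγθ hf I D₀' hD₀' D₀ hD₀ F hF κF γF hκF hγF DF ΘS hΘS Lt m hLt hLt0 D 𝔮 h𝔮 hp𝔮

end PrintExactDoors

end Summit.BirchSwinnertonDyer.BirchSwinnertonDyer.Theorems.AddKatoTwoQuadLayerModel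

end
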